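import Mathlib
import Literature.NumberTheory.LFunctions.Zhang2022.Section7cCauchyStep
import Literature.NumberTheory.LFunctions.Zhang2022.Section7ExtendedRangeLS
import HarnessLib

/-!
# Zhang (2022) §7, G-adj2-1 extended range (F2b): the Cauchy step and the block bound for `r ≥ D`

Topic `Literature/NumberTheory/LFunctions/Zhang2022` (Landau–Siegel audit tree; verdict-neutral).
Y. Zhang, *Discrete mean estimates and the Landau–Siegel zero*, arXiv:2211.02515v1 (2022)
[Zhang2022LandauSiegel] — **an unrefereed manuscript under adjudication**. D-0069 campaign, cell
`siegel-zhang`, §7 error-term subsection, GAP-LEDGER row G-adj2-1 discharge lane.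

The X-RANGE is `D ≤ R`, `R·dh ≤ PT⁻²` (the full (7.2) support; no `dhr < P₁` restriction).
This file completes the extended-range dyadic-block machinery:

* `step7u041X_first` — the Cauchy composition on the X-range: from the range-free Mellin bound
  with its factor `hr ≤ 2hR` (`step7u038_hr`), the X-range `l`-large sieve (`step7u039X`, F2a)
  and the range-free `p`-large sieve (`step7u040_holds`),
  `R^{−3/2} Σ_{R≤r<2R} Σ*_θ |𝔰*| ≤ C·τ₅(d)h𝓛ᵏ(R^{1/2}P^{3/2} + R^{−1/2}P²)` — the landed
  `first_bound_of_weighted` verbatim in the X-binders.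
* `step7u041X_right` — **the one materially range-sensitive step of the whole §7 chain**: on the
  printed range the budget closes via `R^{1/2} ≤ P^{0.252}`; on the X-range via
  `R^{1/2} ≤ (PT⁻²)^{1/2} = P^{1/2}T⁻¹`, so `𝓛ᵏR^{1/2}P^{3/2} ≤ 𝓛ᵏP²T⁻¹ ≤ C·P²D^{−1/16}`
  (`T = exp(𝓛^{1.1})`; the `T⁻¹`-saving is the G-adj2-1 repair arithmetic of the row).
* `eq715X` — the extended-range (7.15): `R^{−3/2} Σ_{R≤r<2R} Σ*_θ |𝔰| ≤ C·τ₅(d)hP²D^{−c}` on the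
  X-range, from `step7bTruncIX` (F2a) and the two bounds above (the landed
  `eq715_of_truncI_u041` bookkeeping verbatim).

Theorems only; 0 new definitions; 0 new facts. The aggregation over triples and the honest
(7.12)→(7.13) insertion are the final file (F3) of the rung.

WHAT THIS IS NOT: any claim about Theorems 1–2 of the manuscript or about Landau–Siegel zeros;
not a proof of (7.11), (7.13) or the printed (7.15); no change to the G-adj2-1 row.

## References

* Y. Zhang, arXiv:2211.02515v1 (2022), §7 pp. 38–39, (7.15), §7.u038–u041, tex L2028–L2058.
  [cite: Zhang2022LandauSiegel, §7 pp. 38–39]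
-/

noncomputable section

open Complex Real Finset MeasureTheory

namespace Literature.NumberTheory.LFunctions.Zhang2022.Section7cStatements

open Literature.NumberTheory.LFunctions.Zhang2022.Skeleton

open scoped Classical

/-! ## Elementary helpers (local copies of private lemmas of the lane, unchanged) -/

/-- `log D ≥ 1` once `D ≥ 3` (local copy). [folklore] -/
private theorem one_le_ellB {D : ℕ} (hD : 3 ≤ D) : 1 ≤ Skeleton.ell D := by
  have hD' : (3 : ℝ) ≤ D := by exact_mod_cast hD
  rw [Skeleton.ell, Real.le_log_iff_exp_le (by linarith)]
  exact le_trans (le_of_lt (lt_trans Real.exp_one_lt_d9 (by norm_num))) hD'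

/-- `1 ≤ P` (local copy). [folklore] -/
private theorem one_le_bigPB (D : ℕ) : 1 ≤ Skeleton.bigP D :=
  Real.one_le_exp (by rw [Skeleton.ell]; positivity)

/-- `1 ≤ τ₅(d)` for `d ≥ 1` (local copy). [folklore] -/
private theorem one_le_tau_fiveB {l : ℕ} (hl : l ≠ 0) : 1 ≤ MeanSquareMajorant.tau 5 l := by
  have key : ∀ j : ℕ, 1 ≤ MeanSquareMajorant.tau (j + 1) l := by
    intro j
    induction j with
    | zero => rw [MeanSquareMajorant.tau_one_apply hl]
    | succ j ih =>
      rw [MeanSquareMajorant.tau_succ_apply]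
      calc (1 : ℝ) ≤ MeanSquareMajorant.tau (j + 1) l := ih
        _ ≤ ∑ e ∈ l.divisors, MeanSquareMajorant.tau (j + 1) e :=
          Finset.single_le_sum (f := fun e => MeanSquareMajorant.tau (j + 1) e)
            (fun e _ => MeanSquareMajorant.tau_nonneg (j + 1) e) (Nat.mem_divisors_self l hl)
  exact key 4

/-- `Re β₃ = 0` (local copy). [cite: Zhang2022LandauSiegel, §2 (2.13)] -/
private theorem beta3_reB (c' : ℝ) (D : ℕ) : (Skeleton.beta3 c' D).re = 0 := by
  rw [beta3_eq_mul_I, Complex.re_ofReal_mul, Complex.I_re, mul_zero]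

/-- `√((R² + P)P³) ≤ RP^{3/2} + P²` for `R, P ≥ 0` (local copy). [folklore] -/
private theorem sqrt_main_leB {R P : ℝ} (hR : 0 ≤ R) (hP : 0 ≤ P) :
    Real.sqrt ((R ^ 2 + P) * P ^ 3) ≤ R * P ^ (3 / 2 : ℝ) + P ^ 2 := by
  have hP32 : (P ^ (3 / 2 : ℝ)) ^ 2 = P ^ 3 := by
    rw [← Real.rpow_natCast _ 2, ← Real.rpow_mul hP,
      show (3 / 2 : ℝ) * ((2 : ℕ) : ℝ) = ((3 : ℕ) : ℝ) by norm_num, Real.rpow_natCast]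
  have h0 : 0 ≤ R * P ^ (3 / 2 : ℝ) + P ^ 2 := by positivity
  rw [Real.sqrt_le_left h0]
  have hx : 0 ≤ R * P ^ (3 / 2 : ℝ) * P ^ 2 := by positivity
  nlinarith [hP32, hx]

/-- Members of `𝔌(y) ∩ ℕ` are positive (local copy). [folklore] -/
private theorem pos_of_mem_natIB {D : ℕ} {y : ℝ} {l : ℕ} (hl : l ∈ natI D y) : 0 < l :=
  ((Finset.mem_filter.1 hl).2).1

/-- The `l`-polynomial is continuous along the line `s = 1 + it` (local copy). [folklore] -/
private theorem continuous_lPoly_lineB (c' : ℝ) (D : ℕ) (a₁ : ℕ → ℂ) (R : ℝ) (r h d : ℕ)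
    (θ : DirichletCharacter ℂ r) :
    Continuous fun t : ℝ => lPoly c' D a₁ R r h d θ (1 + t * I) := by
  unfold lPoly
  refine continuous_finsetSum _ fun l hl => ?_
  have hl0 : (l : ℂ) ≠ 0 := by
    have h0 : 0 < l := pos_of_mem_natIB (Finset.mem_filter.1 hl).1
    exact_mod_cast h0.ne'
  exact continuous_const.mul (Continuous.const_cpow (by fun_prop) (Or.inl hl0))

/-- The prime polynomial is continuous along the line `s = 1 + it + β₃` (local copy). [folklore] -/
private theorem continuous_pPoly_lineB (c' : ℝ) (D r : ℕ) (θ : DirichletCharacter ℂ r) :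
    Continuous fun t : ℝ => pPoly D r θ (1 + t * I + Skeleton.beta3 c' D) := by
  unfold pPoly
  refine continuous_finsetSum _ fun p hp => ?_
  have hp0 : (p : ℂ) ≠ 0 := by
    have h0 : p.Prime := (Finset.mem_filter.mp hp).2
    exact_mod_cast h0.ne_zero
  exact continuous_const.mul (Continuous.const_cpow (by fun_prop) (Or.inl hp0))

/-- `𝓛ᵏ ≤ 8ᵏ·k!·e^{𝓛/8}` (local copy; from `xᵏ/k! ≤ eˣ`). [folklore] -/
private theorem ell_pow_leB (k : ℕ) {D : ℕ} (hD : 3 ≤ D) :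
    Skeleton.ell D ^ k ≤ 8 ^ k * k.factorial * Real.exp (Skeleton.ell D / 8) := by
  have hL : 0 ≤ Skeleton.ell D := zero_le_one.trans (one_le_ellB hD)
  have h := Real.pow_div_factorial_le_exp (Skeleton.ell D / 8) (by positivity) k
  rw [div_pow, div_div, div_le_iff₀ (by positivity)] at h
  calc Skeleton.ell D ^ k ≤ Real.exp (Skeleton.ell D / 8) * (8 ^ k * k.factorial) := h
    _ = 8 ^ k * k.factorial * Real.exp (Skeleton.ell D / 8) := by ring

open scoped Classical in
/-- The primitive-character double sum as one sigma-sum (local copy). [folklore] -/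
private theorem sum_prim_eq_sum_sigmaB (R : ℝ) (v : (r : ℕ) → DirichletCharacter ℂ r → ℝ) :
    (∑ r ∈ dyadic R, ∑ θ : DirichletCharacter ℂ r, if θ.IsPrimitive then v r θ else 0) =
      ∑ x ∈ (dyadic R).sigma (fun r =>
          (Finset.univ : Finset (DirichletCharacter ℂ r)).filter fun θ => θ.IsPrimitive),
        v x.1 x.2 := by
  rw [Finset.sum_sigma]
  exact Finset.sum_congr rfl fun r _ => (Finset.sum_filter _ _).symm

/-- The X-range basics: `1 ≤ R` and `R ≤ P` (local copy of the F2a extraction, trimmed).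
[folklore] -/
private theorem xrange_R_le_P {D d h : ℕ} {R : ℝ} (hD3 : 3 ≤ D) (hd : 0 < d) (hh : 0 < h)
    (hDR : (D : ℝ) ≤ R)
    (hRX : R * ((d * h : ℕ) : ℝ) ≤ Skeleton.bigP D / Skeleton.bigT D ^ 2) :
    1 ≤ R ∧ R ≤ Skeleton.bigP D / Skeleton.bigT D ^ 2 ∧ R ≤ Skeleton.bigP D := by
  have hℓ1 : 1 ≤ Skeleton.ell D := one_le_ellB hD3
  have hℓ0 : 0 < Skeleton.ell D := by linarith
  have hT1 : 1 ≤ Skeleton.bigT D :=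
    Real.one_le_exp (Real.rpow_nonneg (le_of_lt hℓ0) _)
  have hT21 : 1 ≤ Skeleton.bigT D ^ 2 := one_le_pow₀ hT1
  have hP : 0 < Skeleton.bigP D := Real.exp_pos _
  have hPT : Skeleton.bigP D / Skeleton.bigT D ^ 2 ≤ Skeleton.bigP D :=
    div_le_self hP.le hT21
  have hR1 : 1 ≤ R := le_trans (by exact_mod_cast (show 1 ≤ D by omega)) hDR
  have hdh1 : (1 : ℝ) ≤ ((d * h : ℕ) : ℝ) := by
    exact_mod_cast Nat.one_le_iff_ne_zero.mpr (Nat.mul_ne_zero hd.ne' hh.ne')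
  have hRPT : R ≤ Skeleton.bigP D / Skeleton.bigT D ^ 2 := by
    have h1 : R ≤ R * ((d * h : ℕ) : ℝ) := le_mul_of_one_le_right (by linarith) hdh1
    exact h1.trans hRX
  exact ⟨hR1, hRPT, hRPT.trans hPT⟩

/-! ## The Cauchy composition on the X-range -/

set_option maxHeartbeats 800000 in
/-- **`§7.u041`, first bound, on the X-range** (`D ≤ R`, `R·dh ≤ PT⁻²`): by Cauchy's inequality in
`(r, θ)` inside the `t`-integral, from the range-free Mellin bound `step7u038_hr` (factor
`hr ≤ 2hR`), the X-range `l`-large sieve `step7u039X` and the range-free `p`-large sieve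
`step7u040_holds`:
`R^{−3/2} Σ_{R≤r<2R} Σ*_θ |𝔰*(R,r,h,d;θ)| ≤ C·τ₅(d)h𝓛ᵏ(R^{1/2}P^{3/2} + R^{−1/2}P²)`.
[cite: Zhang2022LandauSiegel, §7 p.39, tex L2055] -/
theorem step7u041X_first (c' : ℝ) (B : ℝ) :
    ∃ k : ℕ, ∃ C : ℝ, Skeleton.ForAllLarge fun D _ χ => Skeleton.AssumptionA D χ →
      ∀ a₁ : ℕ → ℂ, Skeleton.Adm72 D B a₁ → ∀ (d h : ℕ) (R : ℝ), 0 < d → 0 < h →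
        (D : ℝ) ≤ R → R * ((d * h : ℕ) : ℝ) ≤ Skeleton.bigP D / Skeleton.bigT D ^ 2 →
          R ^ (-(3 / 2 : ℝ)) * ∑ r ∈ dyadic R, ∑ θ : DirichletCharacter ℂ r,
              (if θ.IsPrimitive then ‖frakSstar c' D a₁ R r h d θ‖ else 0) ≤
            C * MeanSquareMajorant.tau 5 d * (h : ℝ) * Skeleton.ell D ^ k *
              (R ^ (1 / 2 : ℝ) * Skeleton.bigP D ^ (3 / 2 : ℝ) +
                R ^ (-(1 / 2 : ℝ)) * Skeleton.bigP D ^ 2) := by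
  obtain ⟨C₁, D₁, h38⟩ := step7u038_hr c'
  obtain ⟨k₂, C₂, D₂, h39⟩ := step7u039X c' B
  obtain ⟨C₃, D₃, h40⟩ := step7u040_holds
  refine ⟨5190 + k₂, 2 * max C₁ 0 * |C₂| * Real.sqrt (max C₃ 0) * Real.pi,
    max (max D₁ D₂) (max D₃ 3), fun D _ χ hD hq hp hA a₁ ha d h R hd hh hDR hRX => ?_⟩
  have hD₁ : D₁ ≤ D := le_trans (le_trans (le_max_left _ _) (le_max_left _ _)) hD
  have hD₂ : D₂ ≤ D := le_trans (le_trans (le_max_right _ _) (le_max_left _ _)) hD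
  have hD₃ : D₃ ≤ D := le_trans (le_trans (le_max_left _ _) (le_max_right _ _)) hD
  have hD3 : 3 ≤ D := le_trans (le_trans (le_max_right _ _) (le_max_right _ _)) hD
  have hL1 : 1 ≤ Skeleton.ell D := one_le_ellB hD3
  have hD0 : (0 : ℝ) < D := by exact_mod_cast (show 0 < D by omega)
  have hR0 : 0 < R := hD0.trans_le hDR
  have hR1 : 1 ≤ R := le_trans (by exact_mod_cast (show 1 ≤ D by omega)) hDR
  have hP : 0 < Skeleton.bigP D := Real.exp_pos _
  have ht0 : 0 < Skeleton.t0 D := by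
    rw [Skeleton.t0]; exact pow_pos (by linarith) 519
  have hh1 : (1 : ℝ) ≤ h := by exact_mod_cast hh
  have hτ : 0 ≤ MeanSquareMajorant.tau 5 d := MeanSquareMajorant.tau_nonneg _ _
  have H39 := h39 D χ hD₂ hq hp hA a₁ ha d h R hd hh hDR hRX
  have H40 := h40 D χ hD₃ hq hp hA R hR1
  -- the weighted Mellin bound with the factor `h·R`
  have H38 : ∀ r ∈ dyadic R, ∀ θ : DirichletCharacter ℂ r,
      ‖frakSstar c' D a₁ R r h d θ‖ ≤
        2 * max C₁ 0 * Skeleton.ell D ^ 5190 * ((h : ℝ) * R) *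
          ∫ t : ℝ, ‖lPoly c' D a₁ R r h d θ (1 + t * I)‖ *
            ‖pPoly D r θ (1 + t * I + Skeleton.beta3 c' D)‖ / (1 + t ^ 2) := by
    intro r hr θ
    have hrR : R ≤ (r : ℝ) ∧ (r : ℝ) < 2 * R := (Finset.mem_filter.1 hr).2
    have hr1 : (1 : ℝ) ≤ r := le_trans hR1 hrR.1
    have hr0 : 0 < r := by exact_mod_cast (show (0 : ℝ) < r by linarith)
    have H := h38 D χ hD₁ hq hp a₁ R r h d θ hr0 hh
    have hI0 : 0 ≤ ∫ t : ℝ, ‖lPoly c' D a₁ R r h d θ (1 + t * I)‖ *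
        ‖pPoly D r θ (1 + t * I + Skeleton.beta3 c' D)‖ / (1 + t ^ 2) :=
      integral_nonneg fun t => by positivity
    have hL0 : 0 ≤ Skeleton.ell D ^ 5190 :=
      pow_nonneg (by rw [Skeleton.ell]; exact Real.log_natCast_nonneg D) _
    have hhr : ((h * r : ℕ) : ℝ) ≤ (h : ℝ) * (2 * R) := by
      push_cast; exact mul_le_mul_of_nonneg_left hrR.2.le (Nat.cast_nonneg h)
    calc ‖frakSstar c' D a₁ R r h d θ‖
        ≤ C₁ * Skeleton.ell D ^ 5190 * ((h * r : ℕ) : ℝ) *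
            ∫ t : ℝ, ‖lPoly c' D a₁ R r h d θ (1 + t * I)‖ *
              ‖pPoly D r θ (1 + t * I + Skeleton.beta3 c' D)‖ / (1 + t ^ 2) := H
      _ ≤ max C₁ 0 * Skeleton.ell D ^ 5190 * ((h : ℝ) * (2 * R)) *
            ∫ t : ℝ, ‖lPoly c' D a₁ R r h d θ (1 + t * I)‖ *
              ‖pPoly D r θ (1 + t * I + Skeleton.beta3 c' D)‖ / (1 + t ^ 2) := by
          refine mul_le_mul_of_nonneg_right ?_ hI0
          exact mul_le_mul (mul_le_mul_of_nonneg_right (le_max_left _ _) hL0) hhr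
            (Nat.cast_nonneg _) (by positivity)
      _ = 2 * max C₁ 0 * Skeleton.ell D ^ 5190 * ((h : ℝ) * R) *
            ∫ t : ℝ, ‖lPoly c' D a₁ R r h d θ (1 + t * I)‖ *
              ‖pPoly D r θ (1 + t * I + Skeleton.beta3 c' D)‖ / (1 + t ^ 2) := by ring
  -- the constant `C₂` is positive
  have hC₂ : 0 < C₂ := by
    have hQ : 0 < (R ^ 2 + Skeleton.bigP D * R * h * Skeleton.t0 D) /
        (Skeleton.bigP D * R * h * Skeleton.t0 D) := by positivity
    exact hQ.trans_le (H39 0).2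
  -- notation
  set L := Skeleton.ell D with hLdef
  set P := Skeleton.bigP D with hPdef
  set τ := MeanSquareMajorant.tau 5 d with hτdef
  set T : Finset (Σ r : ℕ, DirichletCharacter ℂ r) := (dyadic R).sigma fun r =>
      (Finset.univ : Finset (DirichletCharacter ℂ r)).filter fun θ => θ.IsPrimitive with hTdef
  set lN : (Σ r : ℕ, DirichletCharacter ℂ r) → ℝ → ℝ :=
    fun x t => ‖lPoly c' D a₁ R x.1 h d x.2 (1 + t * I)‖ with hlNdef
  set pN : (Σ r : ℕ, DirichletCharacter ℂ r) → ℝ → ℝ :=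
    fun x t => ‖pPoly D x.1 x.2 (1 + t * I + Skeleton.beta3 c' D)‖ with hpNdef
  set ML : ℝ := C₂ * τ * L ^ k₂ with hMLdef
  set MP : ℝ := Real.sqrt (C₃ * (R ^ 2 + P) * P ^ 3) with hMPdef
  have hML0 : 0 ≤ ML := by positivity
  have hMP0 : 0 ≤ MP := Real.sqrt_nonneg _
  -- (1) the `l`-mean square is at most `ML²`
  have hSL : ∀ t : ℝ, ∑ x ∈ T, lN x t ^ 2 ≤ ML ^ 2 := by
    intro t
    have h1 := (H39 t).1
    have h2 := (H39 t).2
    rw [sum_prim_eq_sum_sigmaB] at h1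
    calc ∑ x ∈ T, lN x t ^ 2 ≤ C₂ * τ ^ 2 * L ^ k₂ *
          ((R ^ 2 + P * R * h * Skeleton.t0 D) / (P * R * h * Skeleton.t0 D)) := h1
      _ ≤ C₂ * τ ^ 2 * L ^ k₂ * C₂ := by gcongr
      _ ≤ C₂ * τ ^ 2 * L ^ k₂ * C₂ * L ^ k₂ := by
          have : 1 ≤ L ^ k₂ := one_le_pow₀ hL1
          nlinarith [mul_nonneg (mul_nonneg (mul_nonneg hC₂.le (sq_nonneg τ)) (pow_nonneg
            (zero_le_one.trans hL1) k₂)) hC₂.le]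
      _ = ML ^ 2 := by rw [hMLdef]; ring
  -- (2) the `p`-mean square is at most `MP²`
  have hSP : ∀ t : ℝ, ∑ x ∈ T, pN x t ^ 2 ≤ MP ^ 2 := by
    intro t
    have hre : (1 + t * I + Skeleton.beta3 c' D).re = 1 := by
      simp [Complex.add_re, beta3_reB]
    have h1 := H40 _ hre
    rw [sum_prim_eq_sum_sigmaB] at h1
    have h0 : 0 ≤ C₃ * (R ^ 2 + P) * P ^ 3 :=
      le_trans (Finset.sum_nonneg fun x _ => sq_nonneg (pN x t)) h1
    rw [hMPdef, Real.sq_sqrt h0]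
    exact h1
  -- (3) pointwise bounds for single terms
  have hlN : ∀ x ∈ T, ∀ t : ℝ, lN x t ≤ ML := by
    intro x hx t
    have h1 : lN x t ^ 2 ≤ ML ^ 2 :=
      le_trans (Finset.single_le_sum (fun y _ => sq_nonneg (lN y t)) hx) (hSL t)
    exact le_trans (le_abs_self _) (abs_le_of_sq_le_sq h1 hML0)
  have hpN : ∀ x ∈ T, ∀ t : ℝ, pN x t ≤ MP := by
    intro x hx t
    have h1 : pN x t ^ 2 ≤ MP ^ 2 :=
      le_trans (Finset.single_le_sum (fun y _ => sq_nonneg (pN y t)) hx) (hSP t)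
    exact le_trans (le_abs_self _) (abs_le_of_sq_le_sq h1 hMP0)
  -- (4) Cauchy's inequality in `(r, θ)`, pointwise in `t`
  have hCS : ∀ t : ℝ, ∑ x ∈ T, lN x t * pN x t ≤ ML * MP := by
    intro t
    have h1 : (∑ x ∈ T, lN x t * pN x t) ^ 2 ≤ (ML * MP) ^ 2 := by
      calc (∑ x ∈ T, lN x t * pN x t) ^ 2 ≤ (∑ x ∈ T, lN x t ^ 2) * ∑ x ∈ T, pN x t ^ 2 :=
            Finset.sum_mul_sq_le_sq_mul_sq _ _ _
        _ ≤ ML ^ 2 * MP ^ 2 :=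
            mul_le_mul (hSL t) (hSP t) (Finset.sum_nonneg fun x _ => sq_nonneg _) (sq_nonneg _)
        _ = (ML * MP) ^ 2 := by ring
    exact le_trans (le_abs_self _) (abs_le_of_sq_le_sq h1 (mul_nonneg hML0 hMP0))
  -- (5) integrability of each integrand
  have hInt : ∀ x ∈ T, Integrable fun t : ℝ => lN x t * pN x t / (1 + t ^ 2) := by
    intro x hx
    refine Integrable.mono' (integrable_inv_one_add_sq.const_mul (ML * MP)) ?_ ?_
    · have hc : Continuous fun t : ℝ => lN x t * pN x t / (1 + t ^ 2) :=
        (((continuous_lPoly_lineB c' D a₁ R x.1 h d x.2).norm).mul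
          ((continuous_pPoly_lineB c' D x.1 x.2).norm)).div (by fun_prop)
          fun t => by positivity
      exact hc.aestronglyMeasurable
    · refine Filter.Eventually.of_forall fun t => ?_
      have h0 : 0 ≤ lN x t * pN x t / (1 + t ^ 2) := by positivity
      rw [Real.norm_of_nonneg h0, div_eq_mul_inv]
      have := hlN x hx t
      have := hpN x hx t
      have : 0 ≤ pN x t := norm_nonneg _
      gcongr
  -- (6) the main chain
  have hstep : ∑ r ∈ dyadic R, ∑ θ : DirichletCharacter ℂ r,
      (if θ.IsPrimitive then ‖frakSstar c' D a₁ R r h d θ‖ else 0) ≤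
        2 * max C₁ 0 * L ^ 5190 * ((h : ℝ) * R) * (ML * MP * Real.pi) := by
    rw [sum_prim_eq_sum_sigmaB]
    calc ∑ x ∈ T, ‖frakSstar c' D a₁ R x.1 h d x.2‖
        ≤ ∑ x ∈ T, 2 * max C₁ 0 * L ^ 5190 * ((h : ℝ) * R) *
            ∫ t : ℝ, lN x t * pN x t / (1 + t ^ 2) := by
          refine Finset.sum_le_sum fun x hx => ?_
          have hr : x.1 ∈ dyadic R := (Finset.mem_sigma.1 hx).1
          exact H38 x.1 hr x.2
      _ = 2 * max C₁ 0 * L ^ 5190 * ((h : ℝ) * R) *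
            ∫ t : ℝ, ∑ x ∈ T, lN x t * pN x t / (1 + t ^ 2) := by
          rw [← Finset.mul_sum, integral_finsetSum _ hInt]
      _ ≤ 2 * max C₁ 0 * L ^ 5190 * ((h : ℝ) * R) * ∫ t : ℝ, ML * MP * (1 + t ^ 2)⁻¹ := by
          refine mul_le_mul_of_nonneg_left ?_ (by positivity)
          refine integral_mono_of_nonneg (Filter.Eventually.of_forall fun t =>
            Finset.sum_nonneg fun x _ => by positivity)
            (integrable_inv_one_add_sq.const_mul (ML * MP))
            (Filter.Eventually.of_forall fun t => ?_)
          have h1t : 0 < 1 + t ^ 2 := by positivity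
          calc ∑ x ∈ T, lN x t * pN x t / (1 + t ^ 2)
              = (∑ x ∈ T, lN x t * pN x t) / (1 + t ^ 2) := by rw [Finset.sum_div]
            _ ≤ ML * MP / (1 + t ^ 2) := by gcongr; exact hCS t
            _ = ML * MP * (1 + t ^ 2)⁻¹ := div_eq_mul_inv _ _
      _ = 2 * max C₁ 0 * L ^ 5190 * ((h : ℝ) * R) * (ML * MP * Real.pi) := by
          rw [integral_const_mul, integral_univ_inv_one_add_sq]
  -- (7) the shape of the bound
  have hMP : MP ≤ Real.sqrt (max C₃ 0) * (R * P ^ (3 / 2 : ℝ) + P ^ 2) := by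
    have hX : 0 ≤ (R ^ 2 + P) * P ^ 3 := by positivity
    calc MP ≤ Real.sqrt (max C₃ 0 * ((R ^ 2 + P) * P ^ 3)) := by
          rw [hMPdef]; apply Real.sqrt_le_sqrt
          rw [mul_assoc]; exact mul_le_mul_of_nonneg_right (le_max_left _ _) hX
      _ = Real.sqrt (max C₃ 0) * Real.sqrt ((R ^ 2 + P) * P ^ 3) :=
          Real.sqrt_mul (le_max_right _ _) _
      _ ≤ Real.sqrt (max C₃ 0) * (R * P ^ (3 / 2 : ℝ) + P ^ 2) := by
          gcongr
          exact sqrt_main_leB hR0.le hP.le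
  have hRR : R ^ (-(3 / 2 : ℝ)) * R * (R * P ^ (3 / 2 : ℝ) + P ^ 2) =
      R ^ (1 / 2 : ℝ) * P ^ (3 / 2 : ℝ) + R ^ (-(1 / 2 : ℝ)) * P ^ 2 := by
    have h1 : R ^ (-(3 / 2 : ℝ)) * R = R ^ (-(1 / 2 : ℝ)) := by
      rw [← Real.rpow_add_one hR0.ne']; norm_num
    have h2 : R ^ (-(1 / 2 : ℝ)) * R = R ^ (1 / 2 : ℝ) := by
      rw [← Real.rpow_add_one hR0.ne']; norm_num
    calc R ^ (-(3 / 2 : ℝ)) * R * (R * P ^ (3 / 2 : ℝ) + P ^ 2)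
        = (R ^ (-(3 / 2 : ℝ)) * R * R) * P ^ (3 / 2 : ℝ) + (R ^ (-(3 / 2 : ℝ)) * R) * P ^ 2 := by
          ring
      _ = R ^ (1 / 2 : ℝ) * P ^ (3 / 2 : ℝ) + R ^ (-(1 / 2 : ℝ)) * P ^ 2 := by rw [h1, h2]
  -- (8) assemble
  have hR32 : 0 ≤ R ^ (-(3 / 2 : ℝ)) := Real.rpow_nonneg hR0.le _
  calc R ^ (-(3 / 2 : ℝ)) * ∑ r ∈ dyadic R, ∑ θ : DirichletCharacter ℂ r,
        (if θ.IsPrimitive then ‖frakSstar c' D a₁ R r h d θ‖ else 0)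
      ≤ R ^ (-(3 / 2 : ℝ)) * (2 * max C₁ 0 * L ^ 5190 * ((h : ℝ) * R) * (ML * MP * Real.pi)) :=
        mul_le_mul_of_nonneg_left hstep hR32
    _ = (2 * max C₁ 0 * C₂ * Real.pi) * τ * (h : ℝ) * L ^ (5190 + k₂) *
          (R ^ (-(3 / 2 : ℝ)) * R * MP) := by
        rw [hMLdef, pow_add]; ring
    _ ≤ (2 * max C₁ 0 * |C₂| * Real.pi) * τ * (h : ℝ) * L ^ (5190 + k₂) *
          (R ^ (-(3 / 2 : ℝ)) * R * (Real.sqrt (max C₃ 0) * (R * P ^ (3 / 2 : ℝ) + P ^ 2))) := by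
        gcongr
        · exact le_abs_self _
    _ = (2 * max C₁ 0 * |C₂| * Real.sqrt (max C₃ 0) * Real.pi) * τ * (h : ℝ) * L ^ (5190 + k₂) *
          (R ^ (-(3 / 2 : ℝ)) * R * (R * P ^ (3 / 2 : ℝ) + P ^ 2)) := by ring
    _ = (2 * max C₁ 0 * |C₂| * Real.sqrt (max C₃ 0) * Real.pi) * τ * (h : ℝ) * L ^ (5190 + k₂) *
          (R ^ (1 / 2 : ℝ) * P ^ (3 / 2 : ℝ) + R ^ (-(1 / 2 : ℝ)) * P ^ 2) := by rw [hRR]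

/-! ## The budget on the X-range: the G-adj2-1 repair arithmetic -/

set_option maxHeartbeats 400000 in
/-- **`§7.u041`, second bound, on the X-RANGE — the one materially range-sensitive step.** In the
ranges `D ≤ R`, `R·dh ≤ PT⁻²`, for every `k`:
`τ₅(d)h𝓛ᵏ(R^{1/2}P^{3/2} + R^{−1/2}P²) ≤ C·τ₅(d)hP²D^{−1/16}`. On the printed range the
`R^{1/2}P^{3/2}` term closes via `R^{1/2} ≤ P₁^{1/2} = P^{0.252}` (power saving); here via
`R^{1/2} ≤ (PT⁻²)^{1/2} = P^{1/2}T⁻¹`, so the term is `≤ 𝓛ᵏP²T⁻¹ = 𝓛ᵏP²e^{−𝓛^{1.1}}`, and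
`e^{𝓛/8}·e^{−𝓛^{1.1}} ≤ e^{−𝓛/16}` since `(3/16)𝓛 ≤ 𝓛^{1.1}` — the G-adj2-1 repair arithmetic
(`R^{1/2}P^{3/2} ≤ P²T⁻¹ ≪ P²D^{−c}`). [cite: Zhang2022LandauSiegel, §7 p.39, tex L2055;
(2.8) tex L1689] -/
theorem step7u041X_right (k : ℕ) : ∃ c : ℝ, 0 < c ∧ ∃ C : ℝ, Skeleton.ForAllLarge fun D _ _ =>
    ∀ (d h : ℕ) (R : ℝ), 0 < d → 0 < h →
      (D : ℝ) ≤ R → R * ((d * h : ℕ) : ℝ) ≤ Skeleton.bigP D / Skeleton.bigT D ^ 2 →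
        MeanSquareMajorant.tau 5 d * (h : ℝ) * Skeleton.ell D ^ k *
            (R ^ (1 / 2 : ℝ) * Skeleton.bigP D ^ (3 / 2 : ℝ) +
              R ^ (-(1 / 2 : ℝ)) * Skeleton.bigP D ^ 2)
          ≤ C * MeanSquareMajorant.tau 5 d * (h : ℝ) * Skeleton.bigP D ^ 2 *
              (D : ℝ) ^ (-c) := by
  refine ⟨1 / 16, by norm_num, 2 * 8 ^ k * k.factorial, 3, fun D _ χ hD _ _ d h R hd hh hDR
    hRX => ?_⟩
  have hL1 : 1 ≤ Skeleton.ell D := one_le_ellB hD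
  have hLk : Skeleton.ell D ^ k ≤ 8 ^ k * k.factorial * Real.exp (Skeleton.ell D / 8) :=
    ell_pow_leB k hD
  set L := Skeleton.ell D with hLdef
  set P := Skeleton.bigP D with hPdef
  have hP : 0 < P := Real.exp_pos _
  have hD0 : (0 : ℝ) < D := by exact_mod_cast (show 0 < D by omega)
  have hD1 : (1 : ℝ) ≤ D := by exact_mod_cast (show 1 ≤ D by omega)
  have hℓ0 : 0 < L := by linarith
  have hT0 : 0 < Skeleton.bigT D := Real.exp_pos _
  have hR0 : 0 < R := hD0.trans_le hDR
  have hdh1 : (1 : ℝ) ≤ ((d * h : ℕ) : ℝ) := by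
    exact_mod_cast Nat.one_le_iff_ne_zero.mpr (Nat.mul_ne_zero hd.ne' hh.ne')
  have hRPT : R ≤ P / Skeleton.bigT D ^ 2 := by
    have h1 : R ≤ R * ((d * h : ℕ) : ℝ) := le_mul_of_one_le_right hR0.le hdh1
    exact h1.trans hRX
  have hlogD : Real.log (D : ℝ) = L := by rw [hLdef, Skeleton.ell]
  have hE : Real.exp (L / 8) = (D : ℝ) ^ (1 / 8 : ℝ) := by
    rw [Real.rpow_def_of_pos hD0, hlogD]; congr 1; ring
  -- the `R^{-1/2}P²` term (uses only `R ≥ D`)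
  have hX2 : Real.exp (L / 8) * R ^ (-(1 / 2 : ℝ)) ≤ (D : ℝ) ^ (-(1 / 16 : ℝ)) := by
    rw [hE]
    calc (D : ℝ) ^ (1 / 8 : ℝ) * R ^ (-(1 / 2 : ℝ))
        ≤ (D : ℝ) ^ (1 / 8 : ℝ) * (D : ℝ) ^ (-(1 / 2 : ℝ)) :=
          mul_le_mul_of_nonneg_left
            (Real.rpow_le_rpow_of_nonpos hD0 hDR (by norm_num : -(1 / 2 : ℝ) ≤ 0))
            (Real.rpow_nonneg hD0.le _)
      _ = (D : ℝ) ^ (-(3 / 8) : ℝ) := by rw [← Real.rpow_add hD0]; norm_num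
      _ ≤ (D : ℝ) ^ (-(1 / 16 : ℝ)) := Real.rpow_le_rpow_of_exponent_le hD1 (by norm_num)
  -- the `R^{1/2}P^{3/2}` term: `R^{1/2} ≤ P^{1/2}/T`, then `e^{L/8}/T ≤ e^{−L/16}`
  have hX1 : Real.exp (L / 8) * R ^ (1 / 2 : ℝ) * P ^ (3 / 2 : ℝ) ≤
      P ^ 2 * (D : ℝ) ^ (-(1 / 16 : ℝ)) := by
    have hT2 : (Skeleton.bigT D ^ 2 : ℝ) ^ (1 / 2 : ℝ) = Skeleton.bigT D := by
      rw [← Real.rpow_natCast (Skeleton.bigT D) 2, ← Real.rpow_mul hT0.le]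
      norm_num
    have hR12 : R ^ (1 / 2 : ℝ) ≤ P ^ (1 / 2 : ℝ) / Skeleton.bigT D := by
      calc R ^ (1 / 2 : ℝ) ≤ (P / Skeleton.bigT D ^ 2) ^ (1 / 2 : ℝ) :=
            Real.rpow_le_rpow hR0.le hRPT (by norm_num)
        _ = P ^ (1 / 2 : ℝ) / (Skeleton.bigT D ^ 2) ^ (1 / 2 : ℝ) :=
            Real.div_rpow hP.le (by positivity) _
        _ = P ^ (1 / 2 : ℝ) / Skeleton.bigT D := by rw [hT2]
    have hP12 : P ^ (1 / 2 : ℝ) * P ^ (3 / 2 : ℝ) = P ^ 2 := by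
      rw [← Real.rpow_add hP, ← Real.rpow_two]
      norm_num
    have hTbig : Real.exp (L / 8) / Skeleton.bigT D ≤ (D : ℝ) ^ (-(1 / 16 : ℝ)) := by
      have hDm : (D : ℝ) ^ (-(1 / 16 : ℝ)) = Real.exp (-(L / 16)) := by
        rw [Real.rpow_def_of_pos hD0, hlogD]; congr 1; ring
      rw [hDm, Skeleton.bigT, div_eq_mul_inv, ← Real.exp_neg, ← Real.exp_add, Real.exp_le_exp]
      have hL11 : L ≤ L ^ (1.1 : ℝ) := by
        calc L = L ^ (1 : ℝ) := (Real.rpow_one L).symm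
          _ ≤ L ^ (1.1 : ℝ) := Real.rpow_le_rpow_of_exponent_le hL1 (by norm_num)
      have : L / 8 + L / 16 ≤ L := by linarith
      linarith
    calc Real.exp (L / 8) * R ^ (1 / 2 : ℝ) * P ^ (3 / 2 : ℝ)
        ≤ Real.exp (L / 8) * (P ^ (1 / 2 : ℝ) / Skeleton.bigT D) * P ^ (3 / 2 : ℝ) := by
          gcongr
      _ = (Real.exp (L / 8) / Skeleton.bigT D) * (P ^ (1 / 2 : ℝ) * P ^ (3 / 2 : ℝ)) := by
          ring
      _ = (Real.exp (L / 8) / Skeleton.bigT D) * P ^ 2 := by rw [hP12]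
      _ ≤ (D : ℝ) ^ (-(1 / 16 : ℝ)) * P ^ 2 := by
          apply mul_le_mul_of_nonneg_right hTbig (by positivity)
      _ = P ^ 2 * (D : ℝ) ^ (-(1 / 16 : ℝ)) := by ring
  -- assemble
  have hτ0 : 0 ≤ MeanSquareMajorant.tau 5 d := MeanSquareMajorant.tau_nonneg _ _
  have hh0 : (0 : ℝ) ≤ h := Nat.cast_nonneg _
  have hfac0 : (0 : ℝ) ≤ 8 ^ k * k.factorial := by positivity
  have hmain : Skeleton.ell D ^ k *
      (R ^ (1 / 2 : ℝ) * P ^ (3 / 2 : ℝ) + R ^ (-(1 / 2 : ℝ)) * P ^ 2) ≤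
        (8 ^ k * k.factorial) * (2 * (P ^ 2 * (D : ℝ) ^ (-(1 / 16 : ℝ)))) := by
    have hsum : Real.exp (L / 8) *
        (R ^ (1 / 2 : ℝ) * P ^ (3 / 2 : ℝ) + R ^ (-(1 / 2 : ℝ)) * P ^ 2) ≤
          2 * (P ^ 2 * (D : ℝ) ^ (-(1 / 16 : ℝ))) := by
      have hP2 : (1 : ℝ) ≤ P ^ 2 := one_le_pow₀ (one_le_bigPB D)
      have t1 : Real.exp (L / 8) * (R ^ (1 / 2 : ℝ) * P ^ (3 / 2 : ℝ)) ≤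
          P ^ 2 * (D : ℝ) ^ (-(1 / 16 : ℝ)) := by
        calc Real.exp (L / 8) * (R ^ (1 / 2 : ℝ) * P ^ (3 / 2 : ℝ))
            = Real.exp (L / 8) * R ^ (1 / 2 : ℝ) * P ^ (3 / 2 : ℝ) := by ring
          _ ≤ P ^ 2 * (D : ℝ) ^ (-(1 / 16 : ℝ)) := hX1
      have t2 : Real.exp (L / 8) * (R ^ (-(1 / 2 : ℝ)) * P ^ 2) ≤
          P ^ 2 * (D : ℝ) ^ (-(1 / 16 : ℝ)) := by
        calc Real.exp (L / 8) * (R ^ (-(1 / 2 : ℝ)) * P ^ 2)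
            = (Real.exp (L / 8) * R ^ (-(1 / 2 : ℝ))) * P ^ 2 := by ring
          _ ≤ (D : ℝ) ^ (-(1 / 16 : ℝ)) * P ^ 2 :=
              mul_le_mul_of_nonneg_right hX2 (by positivity)
          _ = P ^ 2 * (D : ℝ) ^ (-(1 / 16 : ℝ)) := by ring
      calc Real.exp (L / 8) *
          (R ^ (1 / 2 : ℝ) * P ^ (3 / 2 : ℝ) + R ^ (-(1 / 2 : ℝ)) * P ^ 2)
          = Real.exp (L / 8) * (R ^ (1 / 2 : ℝ) * P ^ (3 / 2 : ℝ)) +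
              Real.exp (L / 8) * (R ^ (-(1 / 2 : ℝ)) * P ^ 2) := by ring
        _ ≤ 2 * (P ^ 2 * (D : ℝ) ^ (-(1 / 16 : ℝ))) := by linarith
    have hXnn : 0 ≤ R ^ (1 / 2 : ℝ) * P ^ (3 / 2 : ℝ) + R ^ (-(1 / 2 : ℝ)) * P ^ 2 := by
      positivity
    calc Skeleton.ell D ^ k *
        (R ^ (1 / 2 : ℝ) * P ^ (3 / 2 : ℝ) + R ^ (-(1 / 2 : ℝ)) * P ^ 2)
        ≤ (8 ^ k * k.factorial * Real.exp (L / 8)) *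
            (R ^ (1 / 2 : ℝ) * P ^ (3 / 2 : ℝ) + R ^ (-(1 / 2 : ℝ)) * P ^ 2) :=
          mul_le_mul_of_nonneg_right hLk hXnn
      _ = (8 ^ k * k.factorial) * (Real.exp (L / 8) *
            (R ^ (1 / 2 : ℝ) * P ^ (3 / 2 : ℝ) + R ^ (-(1 / 2 : ℝ)) * P ^ 2)) := by ring
      _ ≤ (8 ^ k * k.factorial) * (2 * (P ^ 2 * (D : ℝ) ^ (-(1 / 16 : ℝ)))) :=
          mul_le_mul_of_nonneg_left hsum hfac0
  calc MeanSquareMajorant.tau 5 d * (h : ℝ) * Skeleton.ell D ^ k *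
      (R ^ (1 / 2 : ℝ) * P ^ (3 / 2 : ℝ) + R ^ (-(1 / 2 : ℝ)) * P ^ 2)
      = MeanSquareMajorant.tau 5 d * (h : ℝ) * (Skeleton.ell D ^ k *
          (R ^ (1 / 2 : ℝ) * P ^ (3 / 2 : ℝ) + R ^ (-(1 / 2 : ℝ)) * P ^ 2)) := by ring
    _ ≤ MeanSquareMajorant.tau 5 d * (h : ℝ) *
          ((8 ^ k * k.factorial) * (2 * (P ^ 2 * (D : ℝ) ^ (-(1 / 16 : ℝ))))) :=
        mul_le_mul_of_nonneg_left hmain (by positivity)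
    _ = 2 * 8 ^ k * k.factorial * MeanSquareMajorant.tau 5 d * (h : ℝ) * P ^ 2 *
          (D : ℝ) ^ (-(1 / 16 : ℝ)) := by ring

/-! ## The extended-range (7.15) -/

set_option maxHeartbeats 400000 in
/-- **The extended-range (7.15)**: there are `c > 0` and `C` with
`R^{−3/2} Σ_{R≤r<2R} Σ*_{θ mod r} |𝔰(r,h,d;θ)| ≤ C·τ₅(d)·h·P²·D^{−c}` for all large `D` under
(A), `𝐚₁` admissible (7.2), `d, h ≥ 1` and every dyadic `R` with `D ≤ R`, `R·dh ≤ PT⁻²` — the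
(7.15) display on the FULL (7.2) support range (the printed `D ≤ R < (dh)⁻¹P₁` is not assumed).
Composition: `|𝔰| ≤ |𝔰*| + e^{−c𝓛¹⁰}` per pair (`step7bTruncIX`), the pair count `≤ 9R²`,
`R ≤ P`, and the two §7.u041 bounds on the X-range (`step7u041X_first/right`) — the landed
`eq715_of_truncI_u041` bookkeeping verbatim. [cite: Zhang2022LandauSiegel, §7 pp. 38–39,
tex L2024–L2058] -/
theorem eq715X (c' : ℝ) (B : ℝ) :
    ∃ c : ℝ, 0 < c ∧ ∃ C : ℝ, Skeleton.ForAllLarge fun D _ χ => Skeleton.AssumptionA D χ →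
      ∀ a₁ : ℕ → ℂ, Skeleton.Adm72 D B a₁ → ∀ (d h : ℕ) (R : ℝ), 0 < d → 0 < h →
        (D : ℝ) ≤ R → R * ((d * h : ℕ) : ℝ) ≤ Skeleton.bigP D / Skeleton.bigT D ^ 2 →
          R ^ (-(3 / 2 : ℝ)) * ∑ r ∈ dyadic R, ∑ θ : DirichletCharacter ℂ r,
              (if θ.IsPrimitive then ‖frakS c' D a₁ r h d θ‖ else 0) ≤
            C * MeanSquareMajorant.tau 5 d * (h : ℝ) * Skeleton.bigP D ^ 2 *
              (D : ℝ) ^ (-c) := by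
  obtain ⟨k, C₁, hA⟩ := step7u041X_first c' B
  obtain ⟨c, hc, C₂, hB⟩ := step7u041X_right k
  obtain ⟨cI, hcI, hIB⟩ := step7bTruncIX c' B
  obtain ⟨D₀, hD₀⟩ := (hA.and hB).and hIB
  refine ⟨min c cI, lt_min hc hcI, max C₁ 0 * C₂ + 9, max D₀ 3, ?_⟩
  intro D _ χ hD hq hp hAx a₁ ha₁ d h R hd hh hDR hRX
  have hD' : D₀ ≤ D := le_trans (le_max_left _ _) hD
  have hD3 : 3 ≤ D := le_trans (le_max_right _ _) hD
  obtain ⟨⟨hA', hB'⟩, hI'⟩ := hD₀ D χ hD' hq hp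
  have h1 := hA' hAx a₁ ha₁ d h R hd hh hDR hRX
  have h2 := hB' d h R hd hh hDR hRX
  have h3 := hI' hAx a₁ ha₁ d h R hd hh hDR hRX
  obtain ⟨hR1, -, hRP1⟩ := xrange_R_le_P hD3 hd hh hDR hRX
  -- the quantities involved
  set τ := MeanSquareMajorant.tau 5 d with hτ
  set P := Skeleton.bigP D with hPdef
  set ℓ := Skeleton.ell D with hℓ
  set X := R ^ (1 / 2 : ℝ) * P ^ (3 / 2 : ℝ) + R ^ (-(1 / 2 : ℝ)) * P ^ 2 with hX
  set E := Real.exp (-cI * ℓ ^ 10) with hE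
  set Sst := ∑ r ∈ dyadic R, ∑ θ : DirichletCharacter ℂ r,
      (if θ.IsPrimitive then ‖frakSstar c' D a₁ R r h d θ‖ else 0) with hSst
  set S := ∑ r ∈ dyadic R, ∑ θ : DirichletCharacter ℂ r,
      (if θ.IsPrimitive then ‖frakS c' D a₁ r h d θ‖ else 0) with hS
  set Ncnt := ∑ r ∈ dyadic R, ∑ θ : DirichletCharacter ℂ r,
      (if θ.IsPrimitive then (1 : ℝ) else 0) with hN
  -- elementary positivity
  have hτ1 : 1 ≤ τ := one_le_tau_fiveB hd.ne'
  have hh1 : (1 : ℝ) ≤ h := by exact_mod_cast hh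
  have hP1 : 1 ≤ P := one_le_bigPB D
  have hℓ1 : 1 ≤ ℓ := one_le_ellB hD3
  have hD1 : (1 : ℝ) ≤ D := by exact_mod_cast (show 1 ≤ D by omega)
  have hDpos : (0 : ℝ) < D := by linarith
  have hR0 : 0 < R := by linarith
  have hX0 : 0 ≤ X := by positivity
  have hE0 : 0 ≤ E := Real.exp_nonneg _
  have hSst0 : 0 ≤ Sst :=
    Finset.sum_nonneg fun _ _ => Finset.sum_nonneg fun _ _ => by split_ifs <;> positivity
  have hN0 : 0 ≤ Ncnt :=
    Finset.sum_nonneg fun _ _ => Finset.sum_nonneg fun _ _ => by split_ifs <;> norm_num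
  have hRpow0 : 0 ≤ R ^ (-(3 / 2 : ℝ)) := Real.rpow_nonneg hR0.le _
  have hRpow1 : R ^ (-(3 / 2 : ℝ)) ≤ 1 := Real.rpow_le_one_of_one_le_of_nonpos hR1 (by norm_num)
  have hY0 : 0 ≤ τ * (h : ℝ) * P ^ 2 := by positivity
  -- (1) `S ≤ S* + E · N`
  have hS1 : S ≤ Sst + E * Ncnt := by
    rw [hS, hSst, hN, Finset.mul_sum, ← Finset.sum_add_distrib]
    refine Finset.sum_le_sum fun r hr => ?_
    rw [Finset.mul_sum, ← Finset.sum_add_distrib]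
    refine Finset.sum_le_sum fun θ _ => ?_
    split_ifs with hθ
    · have hd3 := h3 r hr θ
      have := norm_le_insert' (frakS c' D a₁ r h d θ) (frakSstar c' D a₁ R r h d θ)
      rw [mul_one]
      linarith
    · simp
  -- (2) the `𝔰*` part
  have h1' : R ^ (-(3 / 2 : ℝ)) * Sst ≤ max C₁ 0 * (τ * (h : ℝ) * ℓ ^ k * X) := by
    calc R ^ (-(3 / 2 : ℝ)) * Sst ≤ C₁ * τ * (h : ℝ) * ℓ ^ k * X := h1
      _ = C₁ * (τ * (h : ℝ) * ℓ ^ k * X) := by ring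
      _ ≤ max C₁ 0 * (τ * (h : ℝ) * ℓ ^ k * X) :=
          mul_le_mul_of_nonneg_right (le_max_left _ _) (by positivity)
  have h2' : τ * (h : ℝ) * ℓ ^ k * X ≤ C₂ * (τ * (h : ℝ) * P ^ 2 * (D : ℝ) ^ (-c)) := by
    calc τ * (h : ℝ) * ℓ ^ k * X ≤ C₂ * τ * (h : ℝ) * P ^ 2 * (D : ℝ) ^ (-c) := h2
      _ = C₂ * (τ * (h : ℝ) * P ^ 2 * (D : ℝ) ^ (-c)) := by ring
  have hC₂ : 0 ≤ C₂ := by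
    have hpos : 0 < τ * (h : ℝ) * P ^ 2 * (D : ℝ) ^ (-c) := by positivity
    have : 0 * (τ * (h : ℝ) * P ^ 2 * (D : ℝ) ^ (-c)) ≤
        C₂ * (τ * (h : ℝ) * P ^ 2 * (D : ℝ) ^ (-c)) := by
      rw [zero_mul]; exact le_trans (by positivity) h2'
    exact le_of_mul_le_mul_right this hpos
  -- (3) exponent comparisons
  have hDc : (D : ℝ) ^ (-c) ≤ (D : ℝ) ^ (-min c cI) :=
    Real.rpow_le_rpow_of_exponent_le hD1 (neg_le_neg (min_le_left c cI))
  have hEm : E ≤ (D : ℝ) ^ (-min c cI) := by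
    rw [hE, Real.rpow_def_of_pos hDpos]
    rw [show Real.log (D : ℝ) = ℓ from by rw [hℓ, Skeleton.ell]]
    apply Real.exp_le_exp.mpr
    have hm : min c cI ≤ cI := min_le_right c cI
    have hm0 : 0 ≤ min c cI := le_of_lt (lt_min hc hcI)
    have hℓ10 : ℓ ≤ ℓ ^ 10 := le_self_pow₀ hℓ1 (by norm_num)
    nlinarith [mul_le_mul hm hℓ10 (by linarith) hcI.le]
  -- (4) the `ε` part
  have hNle : Ncnt ≤ 9 * R ^ 2 := by
    have h1c : ∀ r ∈ dyadic R,
        ∑ θ : DirichletCharacter ℂ r, (if θ.IsPrimitive then (1 : ℝ) else 0) ≤ 2 * R + 1 := by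
      intro r hr
      obtain ⟨hRr, hr2⟩ := (Finset.mem_filter.mp hr).2
      have hr1 : (1 : ℝ) ≤ r := le_trans hR1 hRr
      have hr0 : r ≠ 0 := by
        intro h0; subst h0; norm_num at hr1
      haveI : NeZero r := ⟨hr0⟩
      calc ∑ θ : DirichletCharacter ℂ r, (if θ.IsPrimitive then (1 : ℝ) else 0)
          ≤ ∑ _θ : DirichletCharacter ℂ r, (1 : ℝ) :=
            Finset.sum_le_sum fun θ _ => by split_ifs <;> norm_num
        _ = Fintype.card (DirichletCharacter ℂ r) := by simp
        _ = r.totient := by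
            rw [← Nat.card_eq_fintype_card,
              DirichletCharacter.card_eq_totient_of_hasEnoughRootsOfUnity ℂ r]
        _ ≤ r := by exact_mod_cast Nat.totient_le r
        _ ≤ 2 * R + 1 := by linarith
    have hcard : ((dyadic R).card : ℝ) ≤ 2 * R + 1 := by
      have hsub : (dyadic R).card ≤ ⌈2 * R⌉₊ := by
        calc (dyadic R).card ≤ (Finset.range ⌈2 * R⌉₊).card := Finset.card_filter_le _ _
          _ = ⌈2 * R⌉₊ := Finset.card_range _
      calc ((dyadic R).card : ℝ) ≤ ⌈2 * R⌉₊ := by exact_mod_cast hsub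
        _ ≤ 2 * R + 1 := (Nat.ceil_lt_add_one (by linarith)).le
    calc Ncnt ≤ ∑ _r ∈ dyadic R, (2 * R + 1) := Finset.sum_le_sum h1c
      _ = (dyadic R).card * (2 * R + 1) := by rw [Finset.sum_const, nsmul_eq_mul]
      _ ≤ (2 * R + 1) * (2 * R + 1) :=
          mul_le_mul_of_nonneg_right hcard (by linarith)
      _ ≤ (3 * R) * (3 * R) := by nlinarith
      _ = 9 * R ^ 2 := by ring
  have h4 : R ^ (-(3 / 2 : ℝ)) * (E * Ncnt) ≤
      9 * (τ * (h : ℝ) * P ^ 2 * (D : ℝ) ^ (-min c cI)) := by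
    have hR2 : R ^ 2 ≤ P ^ 2 := by gcongr
    calc R ^ (-(3 / 2 : ℝ)) * (E * Ncnt) ≤ 1 * (E * (9 * R ^ 2)) := by
          apply mul_le_mul hRpow1 (mul_le_mul_of_nonneg_left hNle hE0) (by positivity) zero_le_one
      _ = 9 * (E * R ^ 2) := by ring
      _ ≤ 9 * ((D : ℝ) ^ (-min c cI) * P ^ 2) := by gcongr
      _ = 9 * (1 * 1 * P ^ 2 * (D : ℝ) ^ (-min c cI)) := by ring
      _ ≤ 9 * (τ * (h : ℝ) * P ^ 2 * (D : ℝ) ^ (-min c cI)) := by gcongr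
  -- (5) assemble
  have hmain : R ^ (-(3 / 2 : ℝ)) * Sst ≤
      max C₁ 0 * C₂ * (τ * (h : ℝ) * P ^ 2 * (D : ℝ) ^ (-min c cI)) := by
    calc R ^ (-(3 / 2 : ℝ)) * Sst ≤ max C₁ 0 * (τ * (h : ℝ) * ℓ ^ k * X) := h1'
      _ ≤ max C₁ 0 * (C₂ * (τ * (h : ℝ) * P ^ 2 * (D : ℝ) ^ (-c))) :=
          mul_le_mul_of_nonneg_left h2' (le_max_right _ _)
      _ ≤ max C₁ 0 * (C₂ * (τ * (h : ℝ) * P ^ 2 * (D : ℝ) ^ (-min c cI))) := by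
          apply mul_le_mul_of_nonneg_left _ (le_max_right _ _)
          exact mul_le_mul_of_nonneg_left (mul_le_mul_of_nonneg_left hDc hY0) hC₂
      _ = max C₁ 0 * C₂ * (τ * (h : ℝ) * P ^ 2 * (D : ℝ) ^ (-min c cI)) := by ring
  calc R ^ (-(3 / 2 : ℝ)) * S ≤ R ^ (-(3 / 2 : ℝ)) * (Sst + E * Ncnt) :=
        mul_le_mul_of_nonneg_left hS1 hRpow0
    _ = R ^ (-(3 / 2 : ℝ)) * Sst + R ^ (-(3 / 2 : ℝ)) * (E * Ncnt) := by ring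
    _ ≤ max C₁ 0 * C₂ * (τ * (h : ℝ) * P ^ 2 * (D : ℝ) ^ (-min c cI)) +
          9 * (τ * (h : ℝ) * P ^ 2 * (D : ℝ) ^ (-min c cI)) := add_le_add hmain h4
    _ = (max C₁ 0 * C₂ + 9) * τ * (h : ℝ) * P ^ 2 * (D : ℝ) ^ (-min c cI) := by ring

end Literature.NumberTheory.LFunctions.Zhang2022.Section7cStatements
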